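import Summits.QuantumFields.BalabanUV.Beta.GAN24.SoftMinimiserOneStepSup

/-!
# G-an2-4 ∕ (CONV-C), road P2, route R2-S1 — THE HARD SCALAR MINIMISER `H = M·S⁻¹ = G′Q′*(Q′G′Q′*)⁻¹` AT `U = 1`: ITS ONE-STEP
# DIFFERENCE AGAINST THE STAIRCASE IS THE SOFT ONE, EXACTLY — `S′ − S = Q′·(M′ − JM)` (the unit-lattice defect is the block MEAN of
# the soft defect) and `H′v − J(Hv) = (M′ − JM)(S′⁻¹v) − JM·S′⁻¹Q′(M′ − JM)(S⁻¹v)` — hence the all-sites sup law of `H` from the soft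
# law and three ZEROTH-order sup letters, with NO unit-lattice rate input

Unit `b2b-balaban-gan24-p2` (gen 29), BINDER row G-an2-4 ∕ (CONV-C) («the non-abelian one-step η-rate comparison for the constituent
kernels (G_k, H_k, C^{(k)}) at U = 1 — not in print»), road P2; crux team (2).  The fine-leg constituents of the H-type are CONSTRAINED
minimisers: for 0-forms, `Hv` = the minimiser of `½‖∂u‖²` on the affine space `{Q′u = v}` ([B5] (1.103) for scalars ∕ (1.59)–(1.63) for
vector fields; the tree's whole-lattice sibling is `GAN24/SubAveragingMinimiser.Hm`, push-through form).  With the SOFT minimiser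
`M = a′G′Q′*` of `GAN24/SoftMinimiserOneStepSup` and the unit-lattice operator `S = Q′M = a′Q′G′Q′*` (King's alias sum, Bałaban's `aQGQ*`
on 0-forms) one has `H = M·S⁻¹` (`Q′H = 1`).  THIS FILE:
 * §1 `norm_QsOp_mulVec_le` (`|Q′f| ≤ |f|_∞`), `blkInj_eq_smul` (`Q′* = n^d·Q′ᴴ`), **`Savg n a′ := Q′·Msoft`**, `Savg_eq`
   (`= (a′n^d)•Q′G′Q′ᴴ`), `vecMul_QsOp_injective`, **`isUnit_det_Savg`** (`a′ > 0`: `S` is a positive multiple of the congruence of the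
   positive definite `G′` by the surjective `Q′`), **`Mhard n a′ := Msoft·Savg⁻¹`**, `QsOp_mul_Mhard` (`Q′H = 1`), `Mhard_mulVec`;
 * §2 the two-level algebra: **`QsOp_mul_stair`** (`Q′_{RN}·J = Q′_N`, from `ScalarPlantingFaces.QsOp_mul_Qavg0H`), **`Savg_succ_sub`**
   `S′ − S = Q′_{RN}·(M′ − J·M)` — THE UNIT-LATTICE ONE-STEP DEFECT IS THE BLOCK MEAN OF THE SOFT ONE — `inv_sub_inv`, and the EXACT
   identity **`Mhard_succ_sub_stair`** `H′v − J(Hv) = (M′ − JM)(S′⁻¹v) − J·M·S′⁻¹·Q′_{RN}·(M′ − JM)(S⁻¹v)`;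
 * §3 **`norm_Mhard_succ_sub_stair_le`** — if the soft defect is a sup → sup letter of size `ε` (`|w| ≤ b ⟹ |((M′ − JM)w)(x′)| ≤ εb`),
   `|Mw| ≤ m₀|w|`, `|S⁻¹v| ≤ σ|v|`, `|S′⁻¹v| ≤ σ′|v|`, then at EVERY fine site `x′`
   `|(H′v)(x′) − (Hv)(par x′)| ≤ ε·σ′·(1 + m₀σ)·|v|_∞`; `soft_letter` feeds `ε = d·((R−1)∕(RN))·a′(B₁C₁ + B₂C₂)` from the four letters of
   `SoftMinimiserOneStepSup.norm_Msoft_succ_sub_stair_le_of_letters`, `msoft_letter` feeds `m₀ = a′C₀` from the zeroth letter `|G′f| ≤ C₀|f|`,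
   and the END **`norm_Mhard_succ_sub_stair_le_of_letters`** displays all of them: rate `η = N⁻¹` times letters, NO unit-lattice RATE among
   the hypotheses (only the two zeroth-order unit-lattice bounds `σ, σ′` on `S⁻¹`).
HONEST SCOPE.  Scalar (0-form) prototype, `U = 1`, finite torus, every `d`, `N, R ≥ 1`, `a′ > 0`; §1–§2 exact finite-lattice algebra, §3
the triangle inequality; the letters are DISPLAYED HYPOTHESES (no `def … : Prop`, no named fact) and, for the scalar `Gps`, NOT in the
tree (the zeroth entry (s0) is the located gap, GAPS § L-gan24leaf03-g48-1; the unit-lattice bounds `σ, σ′` on `(a′Q′G′Q′*)⁻¹` are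
B4-type unit-lattice facts, also not instantiated here) — the END is CONDITIONAL.  Locators (text only): [Balaban1984PropagatorsI]
(1.103) p. 34, (1.59)–(1.63) pp. 27–28; [King1986] Prop. 3.8 p. 664.  NOT (CONV-C), NEVER «G-an2-4 closed», NOT NE2, NOT D1, NOT
BetaPertH, NOT continuum, NOT Clay; not in print — our proof attempt.  HONEST DEPENDENCY: continuum YM on T⁴ ⇐ BetaPertH ∧ nine spine
estimates (0/9 proved); BetaPertH ⇐ (D1) ∧ (D4) ∧ CAP+tail; G-an2-4 gates asym, D1 and NE2/3/4.
-/

noncomputable section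

open scoped BigOperators ComplexConjugate Matrix ComplexOrder

namespace Summit.QuantumFields.BalabanUV.Beta.GAN24.HardMinimiserOneStepSup

open Literature.MathematicalPhysics.QuantumFieldTheory.Balaban1983to89.B5Prop11Plancherel (Tor fine)
open Literature.MathematicalPhysics.QuantumFieldTheory.Balaban1983to89.B5Action121 (sdiff)
open Literature.MathematicalPhysics.QuantumFieldTheory.Balaban1983to89.B5Block118 (bpt QsOp QsOp_mulVec)
open Literature.MathematicalPhysics.QuantumFieldTheory.Balaban1983to89.B5Blocks16 (blockOf blockOf_bpt)
open Summit.QuantumFields.BalabanUV.T4Continuum.BalabanAveragedTowerModes (par)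
open Summit.QuantumFields.BalabanUV.T4Continuum.ScalarAveragedPropagator (Gps DeltaPs_posDef)
open Summit.QuantumFields.BalabanUV.T4Continuum.ScalarBlockPlanting (Qavg0)
open Summit.QuantumFields.BalabanUV.T4Continuum.ScalarBlockPoincare (QsOp_apply_blockOf)
open Summit.QuantumFields.BalabanUV.T4Continuum.ScalarPlantingFaces (QsOp_mul_Qavg0H)
open Summit.QuantumFields.BalabanUV.Beta.GAN24.StaircaseLaplacianDefect
open Summit.QuantumFields.BalabanUV.Beta.GAN24.SoftMinimiserOneStepSup

variable {d : ℕ}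

/-! ## §1 The unit-lattice operator `S = Q′·M` and the hard minimiser `H = M·S⁻¹` -/

section Unit

variable (n : ℕ) [NeZero n] (M : Fin d → ℕ) [hM : ∀ μ, NeZero (M μ)]

/-- `|(Q′f)(y)| ≤ |f|_∞`: the block mean does not increase the sup norm. [folklore] -/
theorem norm_QsOp_mulVec_le (f : Tor (fine n M) → ℂ) {b : ℝ} (hf : ∀ x, ‖f x‖ ≤ b) (y : Tor M) :
    ‖(QsOp n M *ᵥ f) y‖ ≤ b := by
  have hn : (0 : ℝ) < (n : ℝ) ^ d := pow_pos (by exact_mod_cast Nat.pos_of_ne_zero (NeZero.ne n)) d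
  have hn' : (n : ℝ) ^ d ≠ 0 := hn.ne'
  have hcard : (Finset.univ : Finset (Fin d → Fin n)).card = n ^ d := by
    rw [Finset.card_univ, Fintype.card_fun, Fintype.card_fin, Fintype.card_fin]
  rw [QsOp_mulVec, norm_mul, norm_div, norm_one, norm_pow, Complex.norm_natCast]
  calc 1 / (n : ℝ) ^ d * ‖∑ j : Fin d → Fin n, f (bpt n M y j)‖
      ≤ 1 / (n : ℝ) ^ d * ∑ _j : Fin d → Fin n, b := by
        refine mul_le_mul_of_nonneg_left ((norm_sum_le _ _).trans (Finset.sum_le_sum fun j _ => hf _)) ?_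
        positivity
    _ = b := by rw [Finset.sum_const, hcard, nsmul_eq_mul]; push_cast; field_simp

/-- `Q′* = n^d·Q′ᴴ` (Bałaban's weighted adjoint against the plain conjugate transpose). [folklore] -/
theorem blkInj_eq_smul : blkInj n M = ((n : ℂ) ^ d) • (QsOp n M)ᴴ := by
  have hn : ((n : ℂ) ^ d) ≠ 0 := pow_ne_zero _ (by exact_mod_cast NeZero.ne n)
  ext x y
  rw [blkInj, Matrix.smul_apply, Matrix.conjTranspose_apply, QsOp_apply_blockOf, smul_eq_mul]
  split_ifs with h
  · rw [Complex.star_def, map_div₀, map_one, map_pow, Complex.conj_natCast, mul_one_div_cancel hn]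
  · rw [star_zero, mul_zero]

/-- **`S = Q′·M = a′Q′G′Q′*`**: the unit-lattice «averaged soft minimiser» (King's alias sum ∕ Bałaban's `aQGQ*` on 0-forms). [folklore] -/
def Savg (a' : ℝ) : Matrix (Tor M) (Tor M) ℂ := QsOp n M * Msoft n M a'

/-- `S = (a′n^d)•(Q′G′Q′ᴴ)`. [folklore] -/
theorem Savg_eq (a' : ℝ) : Savg n M a' = ((a' : ℂ) * (n : ℂ) ^ d) • (QsOp n M * Gps n M a' * (QsOp n M)ᴴ) := by
  rw [Savg, Msoft, blkInj_eq_smul, Matrix.mul_smul, Matrix.mul_smul, Matrix.mul_smul, smul_smul, Matrix.mul_assoc]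

/-- `v ↦ v·Q′` is injective (`(v·Q′)(x) = n^{−d}·v(blockOf x)` and `blockOf` is onto). [folklore] -/
theorem vecMul_QsOp_injective : Function.Injective fun v : Tor M → ℂ => Matrix.vecMul v (QsOp n M) := by
  have hn : (1 / (n : ℂ) ^ d) ≠ 0 := one_div_ne_zero (pow_ne_zero _ (by exact_mod_cast NeZero.ne n))
  have key : ∀ (v : Tor M → ℂ) (x : Tor (fine n M)), Matrix.vecMul v (QsOp n M) x = v (blockOf n M x) * (1 / (n : ℂ) ^ d) := by
    intro v x
    simp only [Matrix.vecMul, dotProduct, QsOp_apply_blockOf, mul_ite, mul_zero, Finset.sum_ite_eq, Finset.mem_univ,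
      if_true]
  intro v w h
  dsimp only at h
  funext y
  have hy := congrFun h (bpt n M y 0)
  rw [key, key, blockOf_bpt] at hy
  exact mul_right_cancel₀ hn hy

/-- **`S` is invertible for `a′ > 0`** (`Q′G′Q′ᴴ` is positive definite: `G′` is, and `v ↦ v·Q′` is injective). [folklore] -/
theorem isUnit_det_Savg {a' : ℝ} (ha' : 0 < a') : IsUnit (Savg n M a').det := by
  have hG : (Gps n M a').PosDef := (DeltaPs_posDef n M ha').inv
  have hP : (QsOp n M * Gps n M a' * (QsOp n M)ᴴ).PosDef := hG.mul_mul_conjTranspose_same (vecMul_QsOp_injective n M)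
  rw [Savg_eq, Matrix.det_smul]
  refine (IsUnit.pow _ ?_).mul ((Matrix.isUnit_iff_isUnit_det _).mp hP.isUnit)
  exact isUnit_iff_ne_zero.mpr (mul_ne_zero (by exact_mod_cast ha'.ne') (pow_ne_zero _ (by exact_mod_cast NeZero.ne n)))

/-- **THE HARD SCALAR MINIMISER `H = M·S⁻¹`** (`= G′Q′*(Q′G′Q′*)⁻¹`, `a′` cancels; for every `a′ > 0` this is the constrained minimiser of
`½‖∂u‖²` on `{Q′u = v}`, the scalar shape of [B5] (1.103) — an identification NOT re-proved in this file, which uses only the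
definition `M·S⁻¹`). [cite: Balaban1984PropagatorsI, (1.103) p.34] [folklore] -/
def Mhard (a' : ℝ) : Matrix (Tor (fine n M)) (Tor M) ℂ := Msoft n M a' * (Savg n M a')⁻¹

/-- **`Q′·H = 1`**: the hard minimiser satisfies the constraint exactly. [folklore] -/
theorem QsOp_mul_Mhard {a' : ℝ} (ha' : 0 < a') : QsOp n M * Mhard n M a' = 1 := by
  rw [Mhard, ← Matrix.mul_assoc]
  exact Matrix.mul_nonsing_inv _ (isUnit_det_Savg n M ha')

/-- `Hv = M(S⁻¹v)`. [folklore] -/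
theorem Mhard_mulVec (a' : ℝ) (v : Tor M → ℂ) : Mhard n M a' *ᵥ v = Msoft n M a' *ᵥ ((Savg n M a')⁻¹ *ᵥ v) := by
  rw [Mhard, Matrix.mulVec_mulVec]

/-- the zeroth letter of `M` from that of `G′`: `|G′f| ≤ C₀|f| ⟹ |Mw| ≤ a′C₀|w|` (`Mw = G′(a′Q′*w)`). [folklore] -/
theorem msoft_letter {a' : ℝ} (ha' : 0 < a') {C₀ : ℝ}
    (hC₀ : ∀ (f : Tor (fine n M) → ℂ) (b : ℝ), (∀ y, ‖f y‖ ≤ b) → ∀ z, ‖(Gps n M a' *ᵥ f) z‖ ≤ C₀ * b)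
    (w : Tor M → ℂ) (b : ℝ) (hw : ∀ y, ‖w y‖ ≤ b) (z : Tor (fine n M)) : ‖(Msoft n M a' *ᵥ w) z‖ ≤ a' * C₀ * b := by
  rw [Msoft_mulVec]
  calc _ ≤ C₀ * (a' * b) := hC₀ _ _ (norm_smul_blkInj_mulVec_le n M ha'.le w hw) z
    _ = a' * C₀ * b := by ring

end Unit

/-! ## §2 The two-level algebra: the unit-lattice defect is the block mean of the soft defect -/

section TwoLevel

variable (N R : ℕ) [NeZero N] [NeZero R] (M : Fin d → ℕ) [hM : ∀ μ, NeZero (M μ)]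

/-- **`Q′_{RN}·J = Q′_N`**: the block mean on the finer lattice of a staircase field is the block mean on the coarser lattice
(`ScalarPlantingFaces.QsOp_mul_Qavg0H`, `J = R^d·Q₀ᴴ`). [folklore] -/
theorem QsOp_mul_stair : QsOp (R * N) M * stair N R M = QsOp N M := by
  have hRc : ((R : ℂ) ^ d) ≠ 0 := pow_ne_zero _ (by exact_mod_cast NeZero.ne R)
  rw [stair_eq_smul_Qavg0H, Matrix.mul_smul, QsOp_mul_Qavg0H, smul_smul, mul_inv_cancel₀ hRc, one_smul]

/-- **`S′ − S = Q′_{RN}·(M′ − J·M)`** — THE UNIT-LATTICE ONE-STEP DEFECT IS THE BLOCK MEAN OF THE SOFT ONE. [folklore] -/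
theorem Savg_succ_sub (a' : ℝ) :
    Savg (R * N) M a' - Savg N M a' = QsOp (R * N) M * (Msoft (R * N) M a' - stair N R M * Msoft N M a') := by
  rw [Matrix.mul_sub, ← Matrix.mul_assoc, QsOp_mul_stair]
  rfl

omit [NeZero N] [NeZero R] hM in
/-- `A⁻¹ − B⁻¹ = −A⁻¹(A − B)B⁻¹` for invertible `A, B`. [folklore] -/
theorem inv_sub_inv {ι : Type*} [Fintype ι] [DecidableEq ι] {A B : Matrix ι ι ℂ} (hA : IsUnit A.det) (hB : IsUnit B.det) :
    A⁻¹ - B⁻¹ = -(A⁻¹ * (A - B) * B⁻¹) := by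
  rw [Matrix.mul_sub, Matrix.sub_mul, Matrix.nonsing_inv_mul _ hA, Matrix.one_mul, Matrix.mul_assoc,
    Matrix.mul_nonsing_inv _ hB, Matrix.mul_one, neg_sub]

/-- `S⁻¹v = S′⁻¹v + S′⁻¹Q′_{RN}(M′ − JM)(S⁻¹v)` (second resolvent identity + `Savg_succ_sub`). [folklore] -/
theorem Savg_inv_mulVec_eq {a' : ℝ} (ha' : 0 < a') (v : Tor M → ℂ) :
    (Savg N M a')⁻¹ *ᵥ v = (Savg (R * N) M a')⁻¹ *ᵥ v + (Savg (R * N) M a')⁻¹ *ᵥ (QsOp (R * N) M *ᵥ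
      ((Msoft (R * N) M a' - stair N R M * Msoft N M a') *ᵥ ((Savg N M a')⁻¹ *ᵥ v))) := by
  have hS := isUnit_det_Savg N M ha'
  have hS' := isUnit_det_Savg (R * N) M ha'
  have h1 : ((Savg (R * N) M a')⁻¹ - (Savg N M a')⁻¹) *ᵥ v
      = -(((Savg (R * N) M a')⁻¹ * (QsOp (R * N) M * (Msoft (R * N) M a' - stair N R M * Msoft N M a'))
          * (Savg N M a')⁻¹) *ᵥ v) := by
    rw [inv_sub_inv hS' hS, Savg_succ_sub, Matrix.neg_mulVec]
  rw [Matrix.sub_mulVec] at h1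
  simp only [← Matrix.mulVec_mulVec] at h1
  rw [sub_eq_iff_eq_add] at h1
  rw [h1]
  abel

/-- **THE EXACT ONE-STEP IDENTITY OF THE HARD MINIMISER**:
`H′v − J(Hv) = (M′ − JM)(S′⁻¹v) − J·M·S′⁻¹·Q′_{RN}·(M′ − JM)(S⁻¹v)`. [folklore] -/
theorem Mhard_succ_sub_stair {a' : ℝ} (ha' : 0 < a') (v : Tor M → ℂ) :
    Mhard (R * N) M a' *ᵥ v - stair N R M *ᵥ (Mhard N M a' *ᵥ v)
      = (Msoft (R * N) M a' - stair N R M * Msoft N M a') *ᵥ ((Savg (R * N) M a')⁻¹ *ᵥ v)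
        - stair N R M *ᵥ (Msoft N M a' *ᵥ ((Savg (R * N) M a')⁻¹ *ᵥ (QsOp (R * N) M *ᵥ
            ((Msoft (R * N) M a' - stair N R M * Msoft N M a') *ᵥ ((Savg N M a')⁻¹ *ᵥ v))))) := by
  rw [Mhard_mulVec, Mhard_mulVec]
  conv_lhs => rw [Savg_inv_mulVec_eq N R M ha' v]
  simp only [Matrix.mulVec_add, Matrix.sub_mulVec, ← Matrix.mulVec_mulVec]
  abel

/-! ## §3 The all-sites sup law of the hard minimiser -/

/-- **THE SUP-NORM ONE-STEP LAW OF THE HARD MINIMISER, MODULO THE SOFT DEFECT LETTER AND THREE ZEROTH-ORDER LETTERS.**  If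
`|w| ≤ b ⟹ |((M′ − JM)w)(x′)| ≤ ε·b` (the soft law as a letter), `|Mw| ≤ m₀|w|`, `|S⁻¹v| ≤ σ|v|`, `|S′⁻¹v| ≤ σ′|v|` (sup → sup), then for
`|v| ≤ V` and every fine site `x′`: `|(H′v)(x′) − (Hv)(par x′)| ≤ ε·σ′·(1 + m₀σ)·V`. [folklore] -/
theorem norm_Mhard_succ_sub_stair_le {a' : ℝ} (ha' : 0 < a') {ε m₀ σ σ' V : ℝ}
    (hD : ∀ (w : Tor M → ℂ) (b : ℝ), (∀ y, ‖w y‖ ≤ b) → ∀ x,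
      ‖((Msoft (R * N) M a' - stair N R M * Msoft N M a') *ᵥ w) x‖ ≤ ε * b)
    (hM0 : ∀ (w : Tor M → ℂ) (b : ℝ), (∀ y, ‖w y‖ ≤ b) → ∀ z, ‖(Msoft N M a' *ᵥ w) z‖ ≤ m₀ * b)
    (hS : ∀ (v : Tor M → ℂ) (b : ℝ), (∀ y, ‖v y‖ ≤ b) → ∀ y, ‖((Savg N M a')⁻¹ *ᵥ v) y‖ ≤ σ * b)
    (hS' : ∀ (v : Tor M → ℂ) (b : ℝ), (∀ y, ‖v y‖ ≤ b) → ∀ y, ‖((Savg (R * N) M a')⁻¹ *ᵥ v) y‖ ≤ σ' * b)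
    (v : Tor M → ℂ) (hv : ∀ y, ‖v y‖ ≤ V) (x : Tor (fine (R * N) M)) :
    ‖(Mhard (R * N) M a' *ᵥ v) x - (Mhard N M a' *ᵥ v) (par N R M x)‖ ≤ ε * σ' * (1 + m₀ * σ) * V := by
  have hpt : (Mhard (R * N) M a' *ᵥ v) x - (Mhard N M a' *ᵥ v) (par N R M x)
      = (Mhard (R * N) M a' *ᵥ v - stair N R M *ᵥ (Mhard N M a' *ᵥ v)) x := by
    rw [Pi.sub_apply, stair_mulVec]
  rw [hpt, Mhard_succ_sub_stair N R M ha', Pi.sub_apply]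
  -- the first term: the soft defect on `w′ = S′⁻¹v`
  have h1 := hD _ _ (hS' v V hv) x
  -- the second term: `J·M·S′⁻¹·Q′·(M′ − JM)·(S⁻¹v)`, letter by letter
  have h4 := hD _ _ (hS v V hv)
  have h5 : ∀ y, ‖(QsOp (R * N) M *ᵥ ((Msoft (R * N) M a' - stair N R M * Msoft N M a') *ᵥ
      ((Savg N M a')⁻¹ *ᵥ v))) y‖ ≤ ε * (σ * V) := norm_QsOp_mulVec_le (R * N) M _ h4
  have h7 := hM0 _ _ (hS' _ _ h5)
  have h8 : ‖(stair N R M *ᵥ (Msoft N M a' *ᵥ ((Savg (R * N) M a')⁻¹ *ᵥ (QsOp (R * N) M *ᵥ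
      ((Msoft (R * N) M a' - stair N R M * Msoft N M a') *ᵥ ((Savg N M a')⁻¹ *ᵥ v)))))) x‖
        ≤ m₀ * (σ' * (ε * (σ * V))) := by
    rw [stair_mulVec]; exact h7 _
  calc _ ≤ ε * (σ' * V) + m₀ * (σ' * (ε * (σ * V))) := (norm_sub_le _ _).trans (add_le_add h1 h8)
    _ = ε * σ' * (1 + m₀ * σ) * V := by ring

/-- the soft law of `SoftMinimiserOneStepSup` as a sup → sup letter for the defect operator `M′ − J·M`:
`ε = d·((R−1)∕(RN))·a′·(B₁C₁ + B₂C₂)`. [folklore] -/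
theorem soft_letter {a' : ℝ} (ha' : 0 < a') {B₁ B₂ C₁ C₂ : ℝ}
    (hB₁ : ∀ (μ : Fin d) (g : Tor (fine (R * N) M) → ℂ) (b : ℝ), (∀ y, ‖g y‖ ≤ b) → ∀ x,
      ‖(Gps (R * N) M a' *ᵥ ((sdiff (fine (R * N) M) ((R * N : ℕ) : ℂ) μ)ᴴ *ᵥ
        ((sdiff (fine (R * N) M) ((R * N : ℕ) : ℂ) μ)ᴴ *ᵥ g))) x‖ ≤ B₁ * b)
    (hB₂ : ∀ (μ : Fin d) (g : Tor (fine (R * N) M) → ℂ) (b : ℝ), (∀ y, ‖g y‖ ≤ b) → ∀ x,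
      ‖(Gps (R * N) M a' *ᵥ ((sdiff (fine (R * N) M) ((R * N : ℕ) : ℂ) μ)ᴴ *ᵥ g)) x‖ ≤ B₂ * b)
    (hC₁ : ∀ (μ : Fin d) (f : Tor (fine N M) → ℂ) (b : ℝ), (∀ y, ‖f y‖ ≤ b) → ∀ z,
      ‖(sdiff (fine N M) ((N : ℕ) : ℂ) μ *ᵥ (Gps N M a' *ᵥ f)) z‖ ≤ C₁ * b)
    (hC₂ : ∀ (μ : Fin d) (f : Tor (fine N M) → ℂ) (b : ℝ), (∀ y, ‖f y‖ ≤ b) → ∀ z,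
      ‖((sdiff (fine N M) ((N : ℕ) : ℂ) μ)ᴴ *ᵥ (sdiff (fine N M) ((N : ℕ) : ℂ) μ *ᵥ (Gps N M a' *ᵥ f))) z‖ ≤ C₂ * b)
    (w : Tor M → ℂ) (b : ℝ) (hw : ∀ y, ‖w y‖ ≤ b) (x : Tor (fine (R * N) M)) :
    ‖((Msoft (R * N) M a' - stair N R M * Msoft N M a') *ᵥ w) x‖
      ≤ (d * (((R : ℝ) - 1) / ((R : ℝ) * N)) * (a' * (B₁ * C₁ + B₂ * C₂))) * b := by
  rw [Matrix.sub_mulVec, Pi.sub_apply, ← Matrix.mulVec_mulVec, stair_mulVec]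
  calc _ ≤ d * (((R : ℝ) - 1) / ((R : ℝ) * N)) * (a' * (B₁ * C₁ + B₂ * C₂) * b) :=
        norm_Msoft_succ_sub_stair_le_of_letters N R M ha' hB₁ hB₂ hC₁ hC₂ w hw x
    _ = _ := by ring

/-- **THE SUP-NORM ONE-STEP LAW OF THE HARD MINIMISER, MODULO LETTERS** — the four sup → sup letters of the soft law (`G′∇*`, `∇G′`;
`G′∇*∇*`, `∇*∇G′` — scalar (1.115)-type and second order), the zeroth letter `|G′_Nf| ≤ C₀|f|`, and the two unit-lattice bounds
`|S⁻¹v| ≤ σ|v|`, `|S′⁻¹v| ≤ σ′|v|`; conclusion at EVERY fine site `x′`, for `|v| ≤ V`: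
`|(H′v)(x′) − (Hv)(par x′)| ≤ d·((R−1)∕(RN))·a′(B₁C₁ + B₂C₂)·σ′·(1 + a′C₀σ)·V` — rate `η = N⁻¹`, NO unit-lattice rate among the
hypotheses.  All letters are DISPLAYED HYPOTHESES, not in the tree for the scalar `Gps` (see the header). [folklore] -/
theorem norm_Mhard_succ_sub_stair_le_of_letters {a' : ℝ} (ha' : 0 < a') {B₁ B₂ C₁ C₂ C₀ σ σ' V : ℝ}
    (hB₁ : ∀ (μ : Fin d) (g : Tor (fine (R * N) M) → ℂ) (b : ℝ), (∀ y, ‖g y‖ ≤ b) → ∀ x,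
      ‖(Gps (R * N) M a' *ᵥ ((sdiff (fine (R * N) M) ((R * N : ℕ) : ℂ) μ)ᴴ *ᵥ
        ((sdiff (fine (R * N) M) ((R * N : ℕ) : ℂ) μ)ᴴ *ᵥ g))) x‖ ≤ B₁ * b)
    (hB₂ : ∀ (μ : Fin d) (g : Tor (fine (R * N) M) → ℂ) (b : ℝ), (∀ y, ‖g y‖ ≤ b) → ∀ x,
      ‖(Gps (R * N) M a' *ᵥ ((sdiff (fine (R * N) M) ((R * N : ℕ) : ℂ) μ)ᴴ *ᵥ g)) x‖ ≤ B₂ * b)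
    (hC₁ : ∀ (μ : Fin d) (f : Tor (fine N M) → ℂ) (b : ℝ), (∀ y, ‖f y‖ ≤ b) → ∀ z,
      ‖(sdiff (fine N M) ((N : ℕ) : ℂ) μ *ᵥ (Gps N M a' *ᵥ f)) z‖ ≤ C₁ * b)
    (hC₂ : ∀ (μ : Fin d) (f : Tor (fine N M) → ℂ) (b : ℝ), (∀ y, ‖f y‖ ≤ b) → ∀ z,
      ‖((sdiff (fine N M) ((N : ℕ) : ℂ) μ)ᴴ *ᵥ (sdiff (fine N M) ((N : ℕ) : ℂ) μ *ᵥ (Gps N M a' *ᵥ f))) z‖ ≤ C₂ * b)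
    (hC₀ : ∀ (f : Tor (fine N M) → ℂ) (b : ℝ), (∀ y, ‖f y‖ ≤ b) → ∀ z, ‖(Gps N M a' *ᵥ f) z‖ ≤ C₀ * b)
    (hS : ∀ (v : Tor M → ℂ) (b : ℝ), (∀ y, ‖v y‖ ≤ b) → ∀ y, ‖((Savg N M a')⁻¹ *ᵥ v) y‖ ≤ σ * b)
    (hS' : ∀ (v : Tor M → ℂ) (b : ℝ), (∀ y, ‖v y‖ ≤ b) → ∀ y, ‖((Savg (R * N) M a')⁻¹ *ᵥ v) y‖ ≤ σ' * b)
    (v : Tor M → ℂ) (hv : ∀ y, ‖v y‖ ≤ V) (x : Tor (fine (R * N) M)) :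
    ‖(Mhard (R * N) M a' *ᵥ v) x - (Mhard N M a' *ᵥ v) (par N R M x)‖
      ≤ (d * (((R : ℝ) - 1) / ((R : ℝ) * N)) * (a' * (B₁ * C₁ + B₂ * C₂))) * σ' * (1 + (a' * C₀) * σ) * V :=
  norm_Mhard_succ_sub_stair_le N R M ha' (soft_letter N R M ha' hB₁ hB₂ hC₁ hC₂) (msoft_letter N M ha' hC₀) hS hS' v hv x

end TwoLevel

end Summit.QuantumFields.BalabanUV.Beta.GAN24.HardMinimiserOneStepSup

end
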